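import Summits.ValiantsHypothesis.ValiantsHypothesis.Theorems.FifoMatchingNNDivisionHardExactPencilQPair
import HarnessLib

/-!
# EXACT PENCILS III — ★★★ `exactTilted.Law` HOLDS on the pair cube (block columns, `h_COR(W_π) = 3k`, `UDISJ_k`, rate); exact-vs-box rhs; the TOP law on `Q_pair` (crux `NNDivisionHard`, stmt-ValiantsHypothesis-21181) — `ExactPencil` port part 3/12

Theorems-side port (staged by val-idea-40 g6, C′-census owner per director-valiant R331 (2)(e) / desk #399, for the port hands;
press as `Theorems/FifoMatchingNNDivisionHardExactPencilQPairDecided.lean`, `--kind proof --supports stmt-ValiantsHypothesis-21181 --as helper`; sig-first val-idea-crit-9 g3) of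
§5 (second half), §7 and §8 of val-idea-38 g2's crux workfile `Cruxes/NNDivisionHard/ExactPencil38.lean` REV 16 @4e81d1716f6b (sha16 d9f2e288279a0b09, 3 456 l., FROZEN — final from 38 g2, bus 01:14:51Z; critic of record val-idea-crit-9 g2/g3: `CRITIC-wave6.md` FINAL + V#97 §2 «rev 14/15 δ KERNEL VERIFIED»).  Declaration texts VERBATIM (namespace
`…Theorems.FifoMatching.ExactPencil`; one-line docstrings added where the source had none); the 40-g5 tools the source RESTATED are
DROPPED here and cited BY NAME from the landed ports `…Theorems.FifoMatching.LocatedRows.*` (✓ p680125 … p683387: `T`, `RowFamily`,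
`hCOR`, `exactTilted`, `ExactPencilLaw`, `pinnedRows`, `unflat`, `three_pow_le_of_block`, `two_pow_half_mul_le`, `zgen`, `cubePt`, …) and
`…Theorems.FifoMatching.XcDivision` (`udRow`, `udPt`, `udInd`, `udMat`, …), so that C′ stays ONE Theorems declaration
`LocatedRows.ExactPencilLaw`.  Part 3/12 of the port (imports part 2, `…Theorems.FifoMatchingNNDivisionHardExactPencilQPair`).

* §5 `ι₁e`, `ι₂e`, `Bcol` (`B_S = ι₁(S) ∪ ι₂(Sᶜ)`), `dPair_dotProduct_Bcol`, `Wm_dotProduct_Bcol`, `Wm_dotProduct_udPt_le`, ★ `hCOR_Wm` (`= 3k`),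
  `map_inter_Bcol`, `ud_block` (the `UDISJ_k` pattern), `T_lt_of_block_half` (rate), ★★★ `exactTilted_law_holds_on_qPair`
  (block count by the landed `LocatedRows.three_pow_le_of_block`, `two_pow_half_mul_le`);
* §7 `flat_dotProduct_udPt`, `read_le_box_term`, ★ `hCOR_eq_box_iff` (exactly when the exact rhs equals the box rhs), `hCOR_diagonal`,
  `exactTilted_β_diagonal`, `exactTilted_ρ_eq_entryTilted_ρ`, `hCOR_dPair_lt_box`;
* §8 ★ `exactTilted_block_qPair`, ★★ `cor_add_qPair_decided` (`xc(COR_n + Q_pair) > T c n` eventually, Yannakakis once).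

HONEST LABEL: every theorem here is a DECIDED SPECIES / support lemma for the OPEN law C′ = `LocatedRows.ExactPencilLaw`
(`exactTilted.Law`); the crux 21181 `NNDivisionHard`, C′, `allRows.Law` and COR-VIRTUAL are OPEN; C⁺_entry `LocatedPencilLaw` is
REFUTED (✓ p679540).  VP ≠ VNP is NOT proved here or anywhere in this tree.
-/

set_option autoImplicit false

-- the mandated summit-side namespace repeats a component by design (single-problem summit)
set_option linter.dupNamespace false

noncomputable section

open Matrix Finset
open scoped Pointwise

namespace Summit.ValiantsHypothesis.ValiantsHypothesis.Theorems.FifoMatching.ExactPencil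

open Literature.Barriers.PneNP (HasEFOfSize three_pow_le_card_mul_two_pow_of_cover_univ)
open Summit.ValiantsHypothesis.ValiantsHypothesis.Theorems.FifoMatching.GridCorShadow (four_T_lt_two_pow)
open Literature.Combinatorics.Optimization.FixedSizePsdRank
  (corPolytope flat vecOuter flat_dotProduct_le_of_mem_corPolytope flat_dotProduct_vecOuter)
open Summit.ValiantsHypothesis.ValiantsHypothesis.Theorems.FifoMatching.XcDivision
  (udRow udPt udInd udMat ud_data udInd_apply udInd_sq dot_le_of_mem_convexHull flat_dotProduct_flat)
open Summit.ValiantsHypothesis.ValiantsHypothesis.Theorems.FifoMatching.LocatedRows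
  (T CorVirtualHardN RowFamily corVirtualHardN_of_law flat_le_box entryTilted allRows LocatedPencilLaw
    hCOR le_hCOR exists_eq_hCOR flat_le_hCOR hCOR_le_box exactTilted ExactPencilLaw exactTilted_emb_allRows
    corVirtualHardN_of_exactPencilLaw three_pow_le_of_block two_pow_half_mul_le pinnedRows unflat flat_unflat
    pinnedRows_emb_exactTilted corVirtualHardN_of_pinnedRowsLaw zgen cubePt dotProduct_cubePt)

section QPair
variable {n : ℕ}

/-! ### the block columns `B_S = ι₁(S) ∪ ι₂(Sᶜ)` -/

/-- the embeddings. -/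
def ι₁e (n : ℕ) : Fin (kk n) ↪ Fin n := ⟨ι₁, ι₁_injective⟩
/-- `ι₂` as an embedding `Fin ⌊n/2⌋ ↪ Fin n`. -/
def ι₂e (n : ℕ) : Fin (kk n) ↪ Fin n := ⟨ι₂, ι₂_injective⟩

/-- `B_S := ι₁(S) ∪ ι₂(Sᶜ)` — splits every matched pair. -/
def Bcol (S : Finset (Fin (kk n))) : Finset (Fin n) := S.map (ι₁e n) ∪ Sᶜ.map (ι₂e n)

/-- `ι₁ t ∈ B_S ↔ t ∈ S`. -/
theorem ι₁_mem_Bcol (S : Finset (Fin (kk n))) (t : Fin (kk n)) : ι₁ t ∈ Bcol S ↔ t ∈ S := by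
  unfold Bcol
  rw [Finset.mem_union]
  constructor
  · rintro (h | h)
    · obtain ⟨s, hs, hst⟩ := Finset.mem_map.mp h
      rw [← ι₁_injective hst]; exact hs
    · exfalso
      obtain ⟨s, -, hs⟩ := Finset.mem_map.mp h
      exact ι₁_ne_ι₂ t s hs.symm
  · intro h; left; exact Finset.mem_map.mpr ⟨t, h, rfl⟩

/-- `ι₂ t ∈ B_S ↔ t ∉ S`. -/
theorem ι₂_mem_Bcol (S : Finset (Fin (kk n))) (t : Fin (kk n)) : ι₂ t ∈ Bcol S ↔ t ∉ S := by
  unfold Bcol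
  rw [Finset.mem_union]
  constructor
  · rintro (h | h)
    · exfalso
      obtain ⟨s, -, hs⟩ := Finset.mem_map.mp h
      exact ι₁_ne_ι₂ s t hs
    · obtain ⟨s, hs, hst⟩ := Finset.mem_map.mp h
      rw [← ι₂_injective hst]; exact Finset.mem_compl.mp hs
  · intro h; right; exact Finset.mem_map.mpr ⟨t, Finset.mem_compl.mpr h, rfl⟩

/-- each pin direction reads `1` on every block column: `⟨d_t, x_{B_S}⟩ = 1`. -/
theorem dPair_dotProduct_Bcol (S : Finset (Fin (kk n))) (t : Fin (kk n)) :
    flat (dPair (ι₁ t) (ι₂ t)) ⬝ᵥ udPt (Bcol S) = 1 := by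
  rw [flat_dPair_dotProduct_udPt, udInd_apply, udInd_apply]
  by_cases ht : t ∈ S
  · rw [if_pos ((ι₁_mem_Bcol S t).mpr ht), if_neg (fun h => ((ι₂_mem_Bcol S t).mp h) ht)]; norm_num
  · rw [if_neg (fun h => ht ((ι₁_mem_Bcol S t).mp h)), if_pos ((ι₂_mem_Bcol S t).mpr ht)]; norm_num

/-- `⟨W_π, x_{B_S}⟩ = 3·⌊n/2⌋` (the block columns attain the exact rhs). -/
theorem Wm_dotProduct_Bcol (S : Finset (Fin (kk n))) : flat (Wm n) ⬝ᵥ udPt (Bcol S) = 3 * kk n := by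
  rw [flat_Wm_dotProduct]
  simp_rw [dPair_dotProduct_Bcol]
  rw [Finset.sum_const, Finset.card_univ, Fintype.card_fin, nsmul_eq_mul]
  ring

/-- `⟨W_π, x_b⟩ ≤ 3·⌊n/2⌋` at every vertex. -/
theorem Wm_dotProduct_udPt_le (b : Finset (Fin n)) : flat (Wm n) ⬝ᵥ udPt b ≤ 3 * kk n := by
  rw [flat_Wm_dotProduct]
  calc ∑ t : Fin (kk n), 3 * (flat (dPair (ι₁ t) (ι₂ t)) ⬝ᵥ udPt b)
      ≤ ∑ _t : Fin (kk n), (3 : ℝ) :=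
        Finset.sum_le_sum fun t _ => by linarith [flat_dPair_dotProduct_udPt_le_one (j := ι₁ t) (j' := ι₂ t) b]
    _ = 3 * kk n := by rw [Finset.sum_const, Finset.card_univ, Fintype.card_fin, nsmul_eq_mul]; ring

/-- the exact rhs of the location: `h_COR(W_π) = 3k`. -/
theorem hCOR_Wm : hCOR (Wm n) = 3 * kk n := by
  apply le_antisymm
  · exact Finset.sup'_le _ _ fun b _ => Wm_dotProduct_udPt_le b
  · rw [← Wm_dotProduct_Bcol (∅ : Finset (Fin (kk n)))]; exact le_hCOR _ _

/-- `ι₁(a') ∩ B_S = ι₁(a' ∩ S)` (the UDISJ pattern of rows against block columns). -/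
theorem map_inter_Bcol (a' S : Finset (Fin (kk n))) : a'.map (ι₁e n) ∩ Bcol S = (a' ∩ S).map (ι₁e n) := by
  ext x
  rw [Finset.mem_inter, Finset.mem_map, Finset.mem_map]
  constructor
  · rintro ⟨⟨t, ht, rfl⟩, hx⟩
    exact ⟨t, Finset.mem_inter.mpr ⟨ht, (ι₁_mem_Bcol S t).mp hx⟩, rfl⟩
  · rintro ⟨t, ht, rfl⟩
    exact ⟨⟨t, (Finset.mem_inter.mp ht).1, rfl⟩, (ι₁_mem_Bcol S t).mpr (Finset.mem_inter.mp ht).2⟩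

/-- the clique part of the block: `1 − ⟨udRow ι₁(a'), x_{B_S}⟩ = (1 − |a' ∩ S|)²`. -/
theorem ud_block (a' S : Finset (Fin (kk n))) :
    1 - udRow (a'.map (ι₁e n)) ⬝ᵥ udPt (Bcol S) = (1 - ((a' ∩ S).card : ℝ)) ^ 2 := by
  rw [(ud_data n).2.2.1, map_inter_Bcol, Finset.card_map]

/-- RATE at the pairing face: `3^k ≤ (r+1)·2^k`, `k = ⌊n/2⌋` ⟹ `T c n < r`, eventually in `n`. -/
theorem T_lt_of_block_half (c : ℕ) : ∃ n₀ : ℕ, ∀ n ≥ n₀, ∀ r : ℕ, 3 ^ kk n ≤ (r + 1) * 2 ^ kk n → T c n < r := by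
  obtain ⟨t₁, ht₁⟩ := four_T_lt_two_pow c (c₀ := 1 / 5) (by norm_num)
  refine ⟨max t₁ 16, fun n hn r hr => ?_⟩
  have hn16 : 16 ≤ n := le_of_max_le_right hn
  have hdiv : n ≤ 5 * (kk n / 2) := by unfold kk; omega
  have hreal : (1 / 5 : ℝ) * n ≤ ((kk n / 2 : ℕ) : ℝ) := by
    have : (n : ℝ) ≤ 5 * ((kk n / 2 : ℕ) : ℝ) := by exact_mod_cast hdiv
    linarith
  have h4 := ht₁ n (le_of_max_le_left hn) (kk n / 2) hreal
  have hpow : 2 ^ (kk n / 2) * 2 ^ kk n ≤ (r + 1) * 2 ^ kk n := (two_pow_half_mul_le (kk n)).trans hr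
  have hle : 2 ^ (kk n / 2) ≤ r + 1 := Nat.le_of_mul_le_mul_right hpow (Nat.pos_of_ne_zero (by positivity))
  have hT : 1 ≤ T c n := Nat.one_le_two_pow
  show 2 ^ ((Nat.log 2 n + c) ^ c) < r
  have hT' : (1 : ℕ) ≤ 2 ^ ((Nat.log 2 n + c) ^ c) := Nat.one_le_two_pow
  omega

/-! ### ★★★ the theorem -/

/-- ★★★ **`exactTilted.Law` HOLDS ON THE PAIR CUBE** (the Law's literal currency; budget hypothesis unused). -/
theorem exactTilted_law_holds_on_qPair : ∀ c : ℕ, ∃ n₀ : ℕ, ∀ n ≥ n₀,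
    ∀ (K : ℕ) (e : Fin (K + 1) ≃ Finset (PIdx n)) (r : ℕ),
    HasEFOfSize (convexHull ℝ (Set.range (qPair ∘ e))) r →
    ∀ mm : exactTilted.A n → ℝ, (∀ a j, exactTilted.ρ n a ⬝ᵥ (qPair ∘ e) j ≤ mm a) →
      (∀ a, ∃ j, exactTilted.ρ n a ⬝ᵥ (qPair ∘ e) j = mm a) →
    ∀ (U : exactTilted.A n → Option (Fin r) → ℝ) (V : Finset (Fin n) × Fin (K + 1) → Option (Fin r) → ℝ),
      (∀ a i, 0 ≤ U a i) → (∀ p i, 0 ≤ V p i) →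
      (∀ a b j, (exactTilted.β n a + mm a) - exactTilted.ρ n a ⬝ᵥ (udPt b + (qPair ∘ e) j) = ∑ i, U a i * V (b, j) i) →
      T c n < r := by
  classical
  intro c
  obtain ⟨n₀, hn₀⟩ := T_lt_of_block_half c
  refine ⟨n₀, fun n hn K e r _ mm hle hat U V hU hV hfac => hn₀ n hn r ?_⟩
  -- the block data
  let jstar : Fin (K + 1) := e.symm (Hstar n)
  let row : Finset (Fin (kk n)) → exactTilted.A n := fun a' => (a'.map (ι₁e n), Wm n)
  let col : Finset (Fin (kk n)) → Finset (Fin n) × Fin (K + 1) := fun S => (Bcol S, jstar)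
  have hq : (qPair ∘ e) jstar = qPair (Hstar n) := by simp [jstar]
  -- the common maximiser: `mm (row a') = ρ ⬝ q_{H⋆}`
  have hmm : ∀ a', mm (row a') = (udRow (a'.map (ι₁e n)) + flat (Wm n)) ⬝ᵥ qPair (Hstar n) := by
    intro a'
    obtain ⟨j₀, hj₀⟩ := hat (row a')
    have h1 := hle (row a') jstar
    rw [hq] at h1
    have h2 : exactTilted.ρ n (row a') ⬝ᵥ (qPair ∘ e) j₀ ≤ (udRow (a'.map (ι₁e n)) + flat (Wm n)) ⬝ᵥ qPair (Hstar n) :=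
      score_le_star _ (e j₀)
    rw [hj₀] at h2
    exact le_antisymm h2 h1
  have key := three_pow_le_of_block (ι := Option (Fin r)) U V hU hV row col ?_
  · simpa [Fintype.card_option, Fintype.card_fin] using key
  · intro a' S
    rw [← hfac (row a') (Bcol S) jstar, hq, hmm a']
    show ((1 + hCOR (Wm n)) + (udRow (a'.map (ι₁e n)) + flat (Wm n)) ⬝ᵥ qPair (Hstar n)) -
        (udRow (a'.map (ι₁e n)) + flat (Wm n)) ⬝ᵥ (udPt (Bcol S) + qPair (Hstar n)) = (1 - ((a' ∩ S).card : ℝ)) ^ 2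
    rw [dotProduct_add, add_dotProduct _ _ (udPt (Bcol S)), hCOR_Wm, Wm_dotProduct_Bcol, ← ud_block a' S]
    ring

end QPair

/-! ## §7 (rev 4) Exactly when does the exact right-hand side differ from the box right-hand side? -/

section ExactVsBox

variable {n : ℕ}

/-- `⟨flat W, x_b⟩ = Σ_{i,m} W_im·[i ∈ b][m ∈ b]`. -/
theorem flat_dotProduct_udPt (W : Matrix (Fin n) (Fin n) ℝ) (b : Finset (Fin n)) :
    flat W ⬝ᵥ udPt b = ∑ i, ∑ m, W i m * (udInd b i * udInd b m) := by
  show flat W ⬝ᵥ vecOuter n (udInd b) = _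
  rw [flat_dotProduct_vecOuter]

/-- one box term dominates the corresponding read term at a vertex. -/
theorem read_le_box_term (W : Matrix (Fin n) (Fin n) ℝ) (b : Finset (Fin n)) (i m : Fin n) :
    W i m * (udInd b i * udInd b m) ≤ max (W i m) 0 := by
  rw [udInd_apply, udInd_apply]
  split_ifs <;> simp

/-- ★★ `h_COR(W) = box(W)` **iff the sign pattern of `W` is clique-realizable.** -/
theorem hCOR_eq_box_iff (W : Matrix (Fin n) (Fin n) ℝ) :
    hCOR W = ∑ i, ∑ m, max (W i m) 0 ↔
      ∃ b : Finset (Fin n), ∀ i m, (0 < W i m → i ∈ b ∧ m ∈ b) ∧ (W i m < 0 → ¬ (i ∈ b ∧ m ∈ b)) := by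
  constructor
  · intro h
    obtain ⟨b, hb⟩ := exists_eq_hCOR W
    rw [h, flat_dotProduct_udPt] at hb
    have hnn : ∀ i m, 0 ≤ max (W i m) 0 - W i m * (udInd b i * udInd b m) :=
      fun i m => sub_nonneg.mpr (read_le_box_term W b i m)
    have hzero : ∑ i, ∑ m, (max (W i m) 0 - W i m * (udInd b i * udInd b m)) = 0 := by
      simp only [Finset.sum_sub_distrib]
      linarith
    refine ⟨b, fun i m => ?_⟩
    have him : max (W i m) 0 - W i m * (udInd b i * udInd b m) = 0 := by
      have h1 := (Finset.sum_eq_zero_iff_of_nonneg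
        (fun i _ => Finset.sum_nonneg fun m _ => hnn i m)).mp hzero i (Finset.mem_univ _)
      exact (Finset.sum_eq_zero_iff_of_nonneg (fun m _ => hnn i m)).mp h1 m (Finset.mem_univ _)
    rw [udInd_apply, udInd_apply] at him
    constructor
    · intro hpos
      by_contra hnot
      have h0 : (if i ∈ b then (1:ℝ) else 0) * (if m ∈ b then 1 else 0) = 0 := by
        rcases not_and_or.mp hnot with h' | h' <;> simp [h']
      rw [h0, mul_zero, sub_zero, max_eq_left hpos.le] at him
      linarith
    · intro hneg hin
      rw [if_pos hin.1, if_pos hin.2, mul_one, mul_one, max_eq_right hneg.le] at him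
      linarith
  · rintro ⟨b, hb⟩
    apply le_antisymm (hCOR_le_box W)
    have key : flat W ⬝ᵥ udPt b = ∑ i, ∑ m, max (W i m) 0 := by
      rw [flat_dotProduct_udPt]
      refine Finset.sum_congr rfl fun i _ => Finset.sum_congr rfl fun m _ => ?_
      rw [udInd_apply, udInd_apply]
      rcases lt_trichotomy (W i m) 0 with hlt | heq | hgt
      · have hno := (hb i m).2 hlt
        have h0 : (if i ∈ b then (1:ℝ) else 0) * (if m ∈ b then 1 else 0) = 0 := by
          rcases not_and_or.mp hno with h' | h' <;> simp [h']
        rw [h0, mul_zero, max_eq_right hlt.le]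
      · simp [heq]
      · obtain ⟨hi, hm⟩ := (hb i m).1 hgt
        rw [if_pos hi, if_pos hm, mul_one, mul_one, max_eq_left hgt.le]
    rw [← key]
    exact le_hCOR W b

/-- ★ every DIAGONAL direction is clique-realizable (`b = {σ > 0}`): `h_COR(diag σ) = box(diag σ)` (`= Σ σ⁺`). -/
theorem hCOR_diagonal (σ : Fin n → ℝ) :
    hCOR (Matrix.diagonal σ) = ∑ i, ∑ m, max (Matrix.diagonal σ i m) 0 := by
  refine (hCOR_eq_box_iff _).mpr ⟨Finset.univ.filter (fun i => 0 < σ i), fun i m => ⟨fun h => ?_, fun h hin => ?_⟩⟩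
  · by_cases him : i = m
    · subst him
      rw [Matrix.diagonal_apply_eq] at h
      simp [h]
    · rw [Matrix.diagonal_apply_ne _ him] at h
      exact absurd h (lt_irrefl 0)
  · by_cases him : i = m
    · subst him
      rw [Matrix.diagonal_apply_eq] at h
      have := (Finset.mem_filter.mp hin.1).2
      linarith
    · rw [Matrix.diagonal_apply_ne _ him] at h
      exact absurd h (lt_irrefl 0)

/-- hence on diagonal tilts the exact and the box located families have the SAME right-hand side (and the same row). -/
theorem exactTilted_β_diagonal (a : Finset (Fin n)) (σ : Fin n → ℝ) :
    exactTilted.β n (a, Matrix.diagonal σ) = entryTilted.β n (a, Matrix.diagonal σ) := by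
  show 1 + hCOR (Matrix.diagonal σ) = 1 + ∑ i, ∑ m, max (Matrix.diagonal σ i m) 0
  rw [hCOR_diagonal]

/-- the exact and the box pencil have the SAME rows (only the right-hand sides differ). -/
theorem exactTilted_ρ_eq_entryTilted_ρ (a : Finset (Fin n) × Matrix (Fin n) (Fin n) ℝ) :
    exactTilted.ρ n a = entryTilted.ρ n a := rfl

/-- ★ conversely a NON-realizable pattern is read STRICTLY better by the exact row: e.g. the pairing direction `dPair j m` (`j ≠ m`;
`+1` on the two diagonal entries, `−1` on the two off-diagonal ones) has `h_COR = 1 < 2 = box`. -/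
theorem hCOR_dPair_lt_box {j m : Fin n} (hjm : j ≠ m) :
    hCOR (dPair j m) < ∑ i, ∑ i', max (dPair j m i i') 0 := by
  classical
  have hle : hCOR (dPair j m) ≤ 1 := by
    refine Finset.sup'_le _ _ fun b _ => ?_
    exact flat_dPair_dotProduct_udPt_le_one b
  have hbox : (2 : ℝ) ≤ ∑ i, ∑ i', max (dPair j m i i') 0 := by
    have hj : (1 : ℝ) ≤ ∑ i', max (dPair j m j i') 0 := by
      have := Finset.single_le_sum (f := fun i' => max (dPair j m j i') 0) (fun i' _ => le_max_right _ _)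
        (Finset.mem_univ j)
      refine le_trans ?_ this
      simp [dPair, hjm]
    have hm : (1 : ℝ) ≤ ∑ i', max (dPair j m m i') 0 := by
      have := Finset.single_le_sum (f := fun i' => max (dPair j m m i') 0) (fun i' _ => le_max_right _ _)
        (Finset.mem_univ m)
      refine le_trans ?_ this
      simp [dPair, hjm.symm]
    have h2 := Finset.add_le_sum (f := fun i => ∑ i', max (dPair j m i i') 0)
      (fun i _ => Finset.sum_nonneg fun i' _ => le_max_right _ _) (Finset.mem_univ j) (Finset.mem_univ m) hjm
    linarith
  linarith

end ExactVsBox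

/-! ## §8 (rev 5) The pair cube at the TOP law: `xc(COR_n + Q_pair) > T c n` (Yannakakis, once) -/

section TopLaw

/-- the §5 engine, columns indexed by graphs `H ⊆ PIdx n` directly, no budget hypothesis. -/
theorem exactTilted_block_qPair (c : ℕ) : ∃ n₀ : ℕ, ∀ n ≥ n₀, ∀ (r : ℕ)
    (mm : exactTilted.A n → ℝ), (∀ a H, exactTilted.ρ n a ⬝ᵥ qPair H ≤ mm a) →
      (∀ a, ∃ H, exactTilted.ρ n a ⬝ᵥ qPair H = mm a) →
    ∀ (U : exactTilted.A n → Option (Fin r) → ℝ) (V : Finset (Fin n) × Finset (PIdx n) → Option (Fin r) → ℝ),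
      (∀ a i, 0 ≤ U a i) → (∀ p i, 0 ≤ V p i) →
      (∀ a b H, (exactTilted.β n a + mm a) - exactTilted.ρ n a ⬝ᵥ (udPt b + qPair H) = ∑ i, U a i * V (b, H) i) →
      T c n < r := by
  classical
  obtain ⟨n₀, hn₀⟩ := T_lt_of_block_half c
  refine ⟨n₀, fun n hn r mm hle hat U V hU hV hfac => hn₀ n hn r ?_⟩
  let row : Finset (Fin (kk n)) → exactTilted.A n := fun a' => (a'.map (ι₁e n), Wm n)
  let col : Finset (Fin (kk n)) → Finset (Fin n) × Finset (PIdx n) := fun S => (Bcol S, Hstar n)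
  have hmm : ∀ a', mm (row a') = (udRow (a'.map (ι₁e n)) + flat (Wm n)) ⬝ᵥ qPair (Hstar n) := by
    intro a'
    obtain ⟨H₀, hH₀⟩ := hat (row a')
    have h1 := hle (row a') (Hstar n)
    have h2 : exactTilted.ρ n (row a') ⬝ᵥ qPair H₀ ≤ (udRow (a'.map (ι₁e n)) + flat (Wm n)) ⬝ᵥ qPair (Hstar n) :=
      score_le_star _ H₀
    rw [hH₀] at h2
    exact le_antisymm h2 h1
  have key := three_pow_le_of_block (ι := Option (Fin r)) U V hU hV row col ?_
  · simpa [Fintype.card_option, Fintype.card_fin] using key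
  · intro a' S
    rw [← hfac (row a') (Bcol S) (Hstar n), hmm a']
    show ((1 + hCOR (Wm n)) + (udRow (a'.map (ι₁e n)) + flat (Wm n)) ⬝ᵥ qPair (Hstar n)) -
        (udRow (a'.map (ι₁e n)) + flat (Wm n)) ⬝ᵥ (udPt (Bcol S) + qPair (Hstar n)) = (1 - ((a' ∩ S).card : ℝ)) ^ 2
    rw [dotProduct_add, add_dotProduct _ _ (udPt (Bcol S)), hCOR_Wm, Wm_dotProduct_Bcol, ← ud_block a' S]
    ring

/-- ★★★ **THE PAIR CUBE IS DECIDED AT THE TOP LAW**: eventually in `n`, every extended formulation of `COR(n) + Q_pair` has size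
`> T c n = 2^{(log₂ n + c)^c}` (indeed `(3/2)^{⌊n/2⌋} ≤ r + 1` along the way). -/
theorem cor_add_qPair_decided (c : ℕ) : ∃ n₀ : ℕ, ∀ n ≥ n₀, ∀ r : ℕ,
    HasEFOfSize (corPolytope n + convexHull ℝ (Set.range (qPair (n := n)))) r → T c n < r := by
  classical
  obtain ⟨n₀, hn₀⟩ := exactTilted_block_qPair c
  refine ⟨n₀, fun n hn r hEF => ?_⟩
  obtain ⟨pt_mem, -, -, -⟩ := ud_data n
  let mm : exactTilted.A n → ℝ := fun a =>
    Finset.univ.sup' Finset.univ_nonempty (fun H : Finset (PIdx n) => exactTilted.ρ n a ⬝ᵥ qPair H)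
  have hat : ∀ a, ∃ H, exactTilted.ρ n a ⬝ᵥ qPair H = mm a := fun a => by
    obtain ⟨H, -, hH⟩ := Finset.exists_mem_eq_sup' Finset.univ_nonempty
      (fun H : Finset (PIdx n) => exactTilted.ρ n a ⬝ᵥ qPair H)
    exact ⟨H, hH.symm⟩
  have hle : ∀ a H, exactTilted.ρ n a ⬝ᵥ qPair H ≤ mm a := fun a H =>
    Finset.le_sup' (fun H : Finset (PIdx n) => exactTilted.ρ n a ⬝ᵥ qPair H) (Finset.mem_univ H)
  have hm : ∀ a, ∀ y ∈ convexHull ℝ (Set.range (qPair (n := n))), exactTilted.ρ n a ⬝ᵥ y ≤ mm a := fun a =>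
    dot_le_of_mem_convexHull _ _ _ (by rintro _ ⟨H, rfl⟩; exact hle a H)
  have hq : ∀ H : Finset (PIdx n), qPair H ∈ convexHull ℝ (Set.range (qPair (n := n))) :=
    fun H => subset_convexHull ℝ _ ⟨H, rfl⟩
  have hv : ∀ p : Finset (Fin n) × Finset (PIdx n),
      udPt p.1 + qPair p.2 ∈ corPolytope n + convexHull ℝ (Set.range (qPair (n := n))) :=
    fun p => Set.add_mem_add (pt_mem p.1) (hq p.2)
  have hvalid : ∀ a, ∀ x ∈ corPolytope n + convexHull ℝ (Set.range (qPair (n := n))),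
      exactTilted.ρ n a ⬝ᵥ x ≤ exactTilted.β n a + mm a := by
    rintro a x ⟨p, hp, y, hy, rfl⟩
    rw [dotProduct_add]
    exact add_le_add (exactTilted.valid n a p hp) (hm a y hy)
  obtain ⟨U, V, hU, hV, hfac⟩ := Literature.Barriers.PneNP.HasEFOfSize.exists_nonneg_factorization hEF
    (fun p : Finset (Fin n) × Finset (PIdx n) => udPt p.1 + qPair p.2) hv (exactTilted.ρ n)
    (fun a => exactTilted.β n a + mm a) hvalid
  exact hn₀ n hn r mm hle hat U V hU hV (fun a b H => hfac a (b, H))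

end TopLaw

end Summit.ValiantsHypothesis.ValiantsHypothesis.Theorems.FifoMatching.ExactPencil
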